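import Summits.BirchSwinnertonDyer.BirchSwinnertonDyer.Theses.ThetaPartnerAtTwo
import Summits.BirchSwinnertonDyer.BirchSwinnertonDyer.Theorems.ThetaPartnerAtTwoMazurTateCongruenceAtTwoROfLambda
import Summits.BirchSwinnertonDyer.BirchSwinnertonDyer.Theorems.ThetaPartnerAtTwoMazurTateCongruenceAtTwoRSymbolLayerDepletion
import Summits.BirchSwinnertonDyer.BirchSwinnertonDyer.Theorems.ThetaPartnerAtTwoMazurTateCongruenceAtTwoREulerLayer
import Literature.NumberTheory.EllipticCurves.Sprung2017.SharpFlatPAdicLFunctionTwoProofs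
import Literature.NumberTheory.EllipticCurves.PlusMinusPAdicLFunctionProofs
import Summits.BirchSwinnertonDyer.Rank1Residual.F1Sign2.BranchCongruenceModTwoAtTwoHolds
import HarnessLib

/-!
# Crux `MazurTateCongruenceAtTwoTop` (stmt-BirchSwinnertonDyer-25797) = `MazurTateCongruenceAtTwoR` (stmt-21416) BY NAME,
# route ThetaPartnerAtTwo (K1 row), line `symbol`: THE CRUX FOLLOWS FROM A CONGRUENCE LAW FOR THE DEPLETED
# NÉRON-NORMALISED PLUS-SYMBOL TABLES ON THE `2`-POWER CUSPS (lead prover bsd-wall-tp2-p1 g10)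

HONEST FRAMING. THEOREMS ONLY; the hypothesis (SP2) below is the research content of the crux (Vatsal 1999 (1.6)/(1.13) =
Greenberg–Vatsal 2000 §3 READ AT `p = 2`, in modular-SYMBOL currency — unprinted: mod-`2` multiplicity one); nothing about its
truth is asserted and BSD is not proved by any of this.

THE REDUCTION. The crux quantifies over Pollack pairs, integral multiples `ι G = 2^m ϖ ι L♭`, `ι G_A = 2^{m'} ϖ_A ι L♭_A`, and
asks at every EVEN layer `n` for `2^{m'}(2^m ϖ θ_n(f) ι E_W) − u 2^m(2^{m'} ϖ_A θ_n(f_A) ι E_A) ∈ ι((2^{m+m'+1}, ω_n)Λ)`,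
`E_• = eulerFactorProductInv • 2 S₀`. Three exact pieces of algebra remove `θ`, `Λ`, the Pollack pairs and `(G, m)`:
(i) the `Δ = {±1}` DOUBLING `θ_n(f) = 2·ϑ_n([·]⁺_f)`, `ϑ_n(φ) = Σ_{s mod 2ⁿ} φ(5^s/2^{n+2})(1+X)^s`
(`Sprung2017.mazurTateElement_two_eq`); (ii) the oriented depletion factor at the layer,
`E_W ≡ ∏_{v∈S₀} P_v ∘ (ℓ_v⁻¹(1+X)^{e_v}) (mod ω_n Λ)`, `e_v = (−f_{ℓ_v}) mod 2ⁿ` (`(1+T)^{−f_ℓ} ≡ (1+T)^{e_v}`,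
companion file `…EulerLayer`), and the DEPLETION IDENTITY `ϑ_n(φ)·∏ P_v∘(…) ≡ ϑ_n(φ^{S₀}) (mod ω_n)` with
`φ^{S₀} = eulerDepleteTableList W S₀.toList φ` (companion file `…SymbolLayerDepletion`); (iii) integrality of `2^m ϖ θ_n`
through the Pollack congruence (`exists_coe_eq_C_mul_of_isCongrModOmega`, seat tp2-p1-w2) and uniqueness of division by the
monic `ω_n` (`Polynomial.map_dvd_map`). RESULT (`mazurTateCongruenceAtTwoR_of_depletedSymbolLaw`): the crux FOLLOWS from

  (SP2) for every theta pair `(W, A)` as in the crux, newforms `f, f_A`, period ratios `ϖ, ϖ_A` and every duplicate-free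
  list `l` of odd places containing the bad places of `W` and `A`, there is `u ∈ ℤ₂ˣ` with
  `‖ ϖ·Φ^{l}_W(a/2^{n+2}) − u·ϖ_A·Φ^{l}_A(a/2^{n+2}) ‖₂ ≤ 1` for every even `n` and odd `a`,
  `Φ^{l}_W = eulerDepleteTableList W l [·]⁺_f`, `Φ^{l}_A = eulerDepleteTableList A l [·]⁺_{f_A}`

— a statement about rational modular symbols only, decidable instance by instance (the census object of
V2MT-FALSIFIER-RUN1, 20/20 congruent with `u = 1`), and `u` drops out mod `2` once the doubled tables `2ϖΦ` are `ℤ₂`-valued.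

References: [GreenbergVatsal2000] §1 (8), §3 (13); [Vatsal1999] (1.6), Thm. (1.13); [MazurTateTeitelbaum1986Invent] §I.8, §I.13;
[Pollack2003] Prop. 6.18; [Sprung2017] §1.1.
-/

set_option linter.dupNamespace false
set_option autoImplicit false

noncomputable section

open scoped Classical MatrixGroups ModularForm

open CongruenceSubgroup Polynomial WeierstrassCurve NumberField IsDedekindDomain
  Literature.NumberTheory.EllipticCurves Literature.NumberTheory.EllipticCurves.ModularForms
  Literature.NumberTheory.EllipticCurves.Rank1Residual Literature.NumberTheory.EllipticCurves.GreenbergVatsal2000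
  Literature.NumberTheory.EllipticCurves.Sprung2017
  Summit.BirchSwinnertonDyer.Rank1Residual.Supersingular
  Summit.BirchSwinnertonDyer.BirchSwinnertonDyer.Theorems.ThetaLayerLambdaCongruenceAtTwo

namespace Summit.BirchSwinnertonDyer.BirchSwinnertonDyer.Theorems.MazurTateCongruenceAtTwoR

/-! ## §3. The Mazur–Tate element at `2` as a doubled layer sum over `ℚ₂` -/

section LayerTwo

/-- `θ_n(f)` read in `ℚ₂[X]` is `C 2 · Σ_{s mod 2ⁿ} [5^s/2^{n+2}]⁺_f (1+X)^s` (`Δ = {±1}` doubling,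
`Sprung2017.mazurTateElement_two_eq`). [cite: MazurTateTeitelbaum1986Invent, §I.13 (p = 2: Δ = {±1}, γ = 5) and §I.8] -/
theorem map_mazurTateElement_two_eq_C_two_mul_layerSum {N : ℕ} [NeZero N] (f : CuspForm (Gamma0 N) 2) (n : ℕ) :
    (mazurTateElement f 2 n).map (algebraMap ℚ ℚ_[2]) =
      C (2 : ℚ_[2]) * ∑ s : ZMod (2 ^ n), C ((ratPlusSymbol f
        ((((cyclotomicGenerator 2 : ZMod (2 ^ (n + 2))) ^ s.val).val : ℚ) / (2 : ℚ) ^ (n + 2)) : ℚ) : ℚ_[2]) *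
        (X + 1 : ℚ_[2][X]) ^ s.val := by
  rw [mazurTateElement_two_eq, Polynomial.map_sum, Finset.mul_sum]
  refine Finset.sum_congr rfl fun s _ ↦ ?_
  rw [Polynomial.map_mul, Polynomial.map_pow, Polynomial.map_add, Polynomial.map_X, Polynomial.map_one,
    Polynomial.map_C, eq_ratCast, Rat.cast_mul, Rat.cast_ofNat, map_mul, mul_assoc]

end LayerTwo

/-! ## §4. An atom-level ring identity used in the assembly -/

section Identity

variable {R : Type*} [CommRing R]

/-- The bookkeeping identity of the assembly: with `θ = 2ϑ`, `θ' = 2ϑ'`, `ϑΠ − ϑS = ωh`, `ϑ'Π' − ϑ'S = ωh'`,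
`a·(c·ϖ·θ)·Π − b·(c'·ϖ'·θ')·Π' = (2acc')… ` — precisely:
`a (c ϖ θ) Π − (u b) (c' ϖ' θ') Π' = 2 c c' (·)` in the form consumed below. [folklore] -/
theorem assembly_identity (c c' two ϖ ϖ' u θ θ' ϑ ϑ' ϑS ϑS' P P' ω h h' : R) (hθ : θ = two * ϑ)
    (hθ' : θ' = two * ϑ') (hB : ϑ * P - ϑS = ω * h) (hB' : ϑ' * P' - ϑS' = ω * h') :
    c' * (c * ϖ * θ) * P - u * c * (c' * ϖ' * θ') * P' =
      two * c * c' * (ϖ * ϑS - u * ϖ' * ϑS') + ω * (two * c * c' * (ϖ * h - u * ϖ' * h')) := by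
  rw [hθ, hθ']
  linear_combination (two * c * c' * ϖ) * hB - (two * c * c' * u * ϖ') * hB'

end Identity

/-! ## §5. The crux from the depleted-symbol law (SP2) -/

section Layer

variable {N NA : ℕ} [NeZero N] [NeZero NA] (W A : WeierstrassCurve ℚ) (f : CuspForm (Gamma0 N) 2)
  (fA : CuspForm (Gamma0 NA) 2)

/-- **The layer decomposition** (the common core of both directions). For cusp forms `f, f_A` with Pollack pairs at `2`,
period ratios `ϖ, ϖ_A ∈ ℚ`, integral multiples `ι G = 2^m ϖ ι L♭`, `ι G_A = 2^{m'} ϖ_A ι L♭_A`, curves `W, A` (Euler polynomials),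
a finite set `S₀` of odd places, a unit `u` and an even layer `n`: the crux's left-hand side
`2^{m'}(2^m ϖ θ_n(f) ι E_W) − u 2^m (2^{m'} ϖ_A θ_n(f_A) ι E_A)` is `ι Y` with `Y = Z + ω_n ρ` in `Λ`, `Z ∈ ℤ₂[X]`, and
`Z = 2·2^m·2^{m'}·Δ_n + ω_n·H` in `ℚ₂[X]`, where `Δ_n = Σ_{s mod 2ⁿ} δ_s (1+X)^s`,
`δ_s = ϖ·Φ_W(5^s/2^{n+2}) − u·ϖ_A·Φ_A(5^s/2^{n+2})`, `Φ_• = eulerDepleteTableList • S₀.toList [·]⁺` — the depleted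
Néron-normalised plus-symbol values of (SP2). (Δ-doubling, the depletion identity at the layer, the oriented Euler factor at the
layer, integrality through the Pollack congruence.) [cite: GreenbergVatsal2000, §1 p. 9 (display (8)) and §3 (13)]
[cite: Pollack2003, Prop. 6.18] -/
theorem exists_layer_decomposition {Lplus Lminus LplusA LminusA : IwasawaAlgebra 2} (hPP : IsPollackPair f 2 Lplus Lminus)
    (hPPA : IsPollackPair fA 2 LplusA LminusA) {ϖ ϖA : ℚ} {G GA : IwasawaAlgebra 2} {m m' : ℕ}
    (hG : iwasawaToPowerSeries 2 G =
      PowerSeries.C ((2 : ℚ_[2]) ^ m * (ϖ : ℚ_[2])) * iwasawaToPowerSeries 2 (kobayashiL 1 Lplus Lminus))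
    (hGA : iwasawaToPowerSeries 2 GA =
      PowerSeries.C ((2 : ℚ_[2]) ^ m' * (ϖA : ℚ_[2])) * iwasawaToPowerSeries 2 (kobayashiL 1 LplusA LminusA))
    (S₀ : Finset (HeightOneSpectrum (𝓞 ℚ))) (hS2 : ∀ v ∈ S₀, ((2 : ℕ) : 𝓞 ℚ) ∉ v.asIdeal) (u : ℤ_[2]ˣ) {n : ℕ}
    (hn : Even n) :
    ∃ (Y : IwasawaAlgebra 2) (Z : ℤ_[2][X]) (ρ : IwasawaAlgebra 2) (H : ℚ_[2][X]),
      PowerSeries.C (((2 : ℤ_[2]) ^ m' : ℤ_[2]) : ℚ_[2]) *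
            (PowerSeries.C ((2 : ℚ_[2]) ^ m * (ϖ : ℚ_[2])) *
              ((mazurTateElement f 2 n).map (algebraMap ℚ ℚ_[2]) : PowerSeries ℚ_[2]) *
              iwasawaToPowerSeries 2 (eulerFactorProductInv W 2 S₀)) -
          PowerSeries.C (((u : ℤ_[2]) * (2 : ℤ_[2]) ^ m : ℤ_[2]) : ℚ_[2]) *
            (PowerSeries.C ((2 : ℚ_[2]) ^ m' * (ϖA : ℚ_[2])) *
              ((mazurTateElement fA 2 n).map (algebraMap ℚ ℚ_[2]) : PowerSeries ℚ_[2]) *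
              iwasawaToPowerSeries 2 (eulerFactorProductInv A 2 S₀)) =
        iwasawaToPowerSeries 2 Y ∧
      Y = (Z : PowerSeries ℤ_[2]) +
        (((cyclotomicOmega 2 n).map (Int.castRingHom ℤ_[2]) : ℤ_[2][X]) : PowerSeries ℤ_[2]) * ρ ∧
      Z.map (algebraMap ℤ_[2] ℚ_[2]) =
        C ((2 : ℚ_[2]) * (2 : ℚ_[2]) ^ m * (2 : ℚ_[2]) ^ m') *
          (∑ s : ZMod (2 ^ n), C (((ϖ * eulerDepleteTableList W S₀.toList (ratPlusSymbol f)
              ((((cyclotomicGenerator 2 : ZMod (2 ^ (n + 2))) ^ s.val).val : ℚ) / (2 : ℚ) ^ (n + 2)) : ℚ) : ℚ_[2]) -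
            ((u : ℤ_[2]) : ℚ_[2]) * ((ϖA * eulerDepleteTableList A S₀.toList (ratPlusSymbol fA)
              ((((cyclotomicGenerator 2 : ZMod (2 ^ (n + 2))) ^ s.val).val : ℚ) / (2 : ℚ) ^ (n + 2)) : ℚ) : ℚ_[2])) *
            (X + 1 : ℚ_[2][X]) ^ s.val) +
          ((cyclotomicOmega 2 n).map (Int.castRingHom ℤ_[2])).map (algebraMap ℤ_[2] ℚ_[2]) * H := by
  -- the list of places
  set l : List (HeightOneSpectrum (𝓞 ℚ)) := S₀.toList with hl
  have hl2 : ∀ v ∈ l, ((2 : ℕ) : 𝓞 ℚ) ∉ v.asIdeal := fun v hv ↦ hS2 v (Finset.mem_toList.mp hv)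
  have hlodd : ∀ v ∈ l, ¬ 2 ∣ Rat.HeightOneSpectrum.natGenerator v := fun v hv ↦ not_two_dvd_natGenerator (hl2 v hv)
  have hScop : ∀ v ∈ S₀, (2 : ℕ).Coprime (Rat.HeightOneSpectrum.natGenerator v) := fun v hv ↦
    (Nat.Prime.coprime_iff_not_dvd Nat.prime_two).mpr (not_two_dvd_natGenerator (hS2 v hv))
  -- integrality of `2^m ϖ θ_n(f)`, `2^{m'} ϖ_A θ_n(f_A)` through the Pollack congruences
  have hK : kobayashiL (1 : ℤˣ) Lplus Lminus = Lminus := if_pos rfl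
  have hKA : kobayashiL (1 : ℤˣ) LplusA LminusA = LminusA := if_pos rfl
  rw [hK] at hG
  rw [hKA] at hGA
  obtain ⟨R, -, -, hR, -⟩ := exists_coe_eq_C_mul_of_isCongrModOmega (hPP.2.2.2 n hn)
    (natDegree_mazurTateElement_lt f 2 n) hG
  obtain ⟨RA, -, -, hRA, -⟩ := exists_coe_eq_C_mul_of_isCongrModOmega (hPPA.2.2.2 n hn)
    (natDegree_mazurTateElement_lt fA 2 n) hGA
  -- the oriented Euler factors at the layer
  obtain ⟨ρW, hρW⟩ := exists_eulerFactorProductInv_sub_coe_prod_eq_mul W S₀ n (p := 2)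
  obtain ⟨ρA, hρA⟩ := exists_eulerFactorProductInv_sub_coe_prod_eq_mul A S₀ n (p := 2)
  -- notation
  set ι := iwasawaToPowerSeries 2 with hι
  set ωZ : ℤ_[2][X] := (cyclotomicOmega 2 n).map (Int.castRingHom ℤ_[2]) with hωZ
  set θK : ℚ_[2][X] := (mazurTateElement f 2 n).map (algebraMap ℚ ℚ_[2]) with hθK
  set θAK : ℚ_[2][X] := (mazurTateElement fA 2 n).map (algebraMap ℚ ℚ_[2]) with hθAK
  set FZ : WeierstrassCurve ℚ → HeightOneSpectrum (𝓞 ℚ) → ℤ_[2][X] := fun E v ↦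
    ((E.localPolynomialAt v).map (Int.castRingHom ℤ_[2])).comp
      (C ((Rat.HeightOneSpectrum.natGenerator v : ℤ_[2]).inv) * (X + 1) ^
        (PadicInt.toZModPow n (-(frobeniusExponent 2 (Rat.HeightOneSpectrum.natGenerator v : ℤ_[2])))).val) with hFZ
  set FK : WeierstrassCurve ℚ → HeightOneSpectrum (𝓞 ℚ) → ℚ_[2][X] := fun E v ↦
    ((E.localPolynomialAt v).map (Int.castRingHom ℚ_[2])).comp
      (C ((Rat.HeightOneSpectrum.natGenerator v : ℚ_[2])⁻¹) * (X + 1) ^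
        (PadicInt.toZModPow n (-(frobeniusExponent 2 (Rat.HeightOneSpectrum.natGenerator v : ℤ_[2])))).val) with hFK
  set x : ZMod (2 ^ n) → ℚ := fun s ↦
    ((((cyclotomicGenerator 2 : ZMod (2 ^ (n + 2))) ^ s.val).val : ℚ) / (2 : ℚ) ^ (n + 2)) with hx
  -- the Euler products map to `ℚ₂[X]`
  have hPi : ∀ (E : WeierstrassCurve ℚ), (∏ v ∈ S₀, FZ E v).map (algebraMap ℤ_[2] ℚ_[2]) = ∏ v ∈ S₀, FK E v := by
    intro E
    rw [Polynomial.map_prod]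
    exact Finset.prod_congr rfl fun v hv ↦ map_localPolynomial_comp_eq E v (hScop v hv) _
  have hPil : ∀ (E : WeierstrassCurve ℚ), (l.map (FK E)).prod = ∏ v ∈ S₀, FK E v :=
    fun E ↦ Finset.prod_map_toList S₀ (FK E)
  -- `R ↦ 2^m ϖ θ_n` in `ℚ₂[X]`
  have hRK : R.map (algebraMap ℤ_[2] ℚ_[2]) = C ((2 : ℚ_[2]) ^ m * (ϖ : ℚ_[2])) * θK := by
    apply Polynomial.coe_injective
    rw [Polynomial.coe_mul, Polynomial.coe_C, hθK, hR, ← ResidualThetaLayer.map_coe_polynomial]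
  have hRAK : RA.map (algebraMap ℤ_[2] ℚ_[2]) = C ((2 : ℚ_[2]) ^ m' * (ϖA : ℚ_[2])) * θAK := by
    apply Polynomial.coe_injective
    rw [Polynomial.coe_mul, Polynomial.coe_C, hθAK, hRA, ← ResidualThetaLayer.map_coe_polynomial]
  -- `Δ`-doubling and the depletion identities at the layer
  have hθ := map_mazurTateElement_two_eq_C_two_mul_layerSum f n
  have hθA := map_mazurTateElement_two_eq_C_two_mul_layerSum fA n
  obtain ⟨hW, hhW⟩ := layerSum_mul_prod_dvd_sub_layerSum_eulerDepleteTableList W l hlodd (ratPlusSymbol f)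
    (ratPlusSymbol_neg f) (ratPlusSymbol_add_intCast_eq f) n
  obtain ⟨hA, hhA⟩ := layerSum_mul_prod_dvd_sub_layerSum_eulerDepleteTableList A l hlodd (ratPlusSymbol fA)
    (ratPlusSymbol_neg fA) (ratPlusSymbol_add_intCast_eq fA) n
  have key := assembly_identity (C ((2 : ℚ_[2]) ^ m)) (C ((2 : ℚ_[2]) ^ m')) (C (2 : ℚ_[2])) (C (ϖ : ℚ_[2]))
    (C (ϖA : ℚ_[2])) (C (((u : ℤ_[2]) : ℚ_[2]))) _ _ _ _ _ _ _ _ _ _ _ hθ hθA hhW hhA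
  -- the integral polynomial `Z = 2^{m'} R Π_W − u 2^m R_A Π_A` and its image in `ℚ₂[X]`
  set Z : ℤ_[2][X] := C ((2 : ℤ_[2]) ^ m') * R * ∏ v ∈ S₀, FZ W v -
    C ((u : ℤ_[2]) * (2 : ℤ_[2]) ^ m) * RA * ∏ v ∈ S₀, FZ A v with hZ
  have hZmap : Z.map (algebraMap ℤ_[2] ℚ_[2]) =
      C ((2 : ℚ_[2]) ^ m') * (C ((2 : ℚ_[2]) ^ m) * C (ϖ : ℚ_[2]) * θK) * (l.map (FK W)).prod -
        C (((u : ℤ_[2]) : ℚ_[2])) * C ((2 : ℚ_[2]) ^ m) * (C ((2 : ℚ_[2]) ^ m') * C (ϖA : ℚ_[2]) * θAK) *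
          (l.map (FK A)).prod := by
    have h1 : algebraMap ℤ_[2] ℚ_[2] ((2 : ℤ_[2]) ^ m') = (2 : ℚ_[2]) ^ m' := by rw [map_pow, map_ofNat]
    have h2 : algebraMap ℤ_[2] ℚ_[2] ((u : ℤ_[2]) * (2 : ℤ_[2]) ^ m) = ((u : ℤ_[2]) : ℚ_[2]) * (2 : ℚ_[2]) ^ m := by
      rw [map_mul, map_pow, map_ofNat]; rfl
    rw [hZ, Polynomial.map_sub, Polynomial.map_mul, Polynomial.map_mul, Polynomial.map_mul, Polynomial.map_mul,
      Polynomial.map_C, Polynomial.map_C, h1, h2, hRK, hRAK, hPi, hPi, ← hPil, ← hPil]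
    simp only [map_mul]
  -- the decomposition
  refine ⟨PowerSeries.C ((2 : ℤ_[2]) ^ m') * (R : PowerSeries ℤ_[2]) * eulerFactorProductInv W 2 S₀ -
      PowerSeries.C ((u : ℤ_[2]) * (2 : ℤ_[2]) ^ m) * (RA : PowerSeries ℤ_[2]) * eulerFactorProductInv A 2 S₀,
    Z, PowerSeries.C ((2 : ℤ_[2]) ^ m') * (R : PowerSeries ℤ_[2]) * ρW -
      PowerSeries.C ((u : ℤ_[2]) * (2 : ℤ_[2]) ^ m) * (RA : PowerSeries ℤ_[2]) * ρA,
    C (2 : ℚ_[2]) * C ((2 : ℚ_[2]) ^ m) * C ((2 : ℚ_[2]) ^ m') *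
      (C (ϖ : ℚ_[2]) * hW - C (((u : ℤ_[2]) : ℚ_[2])) * C (ϖA : ℚ_[2]) * hA), ?_, ?_, ?_⟩
  · -- `LHS = ι Y`
    have hCa : PowerSeries.C (((2 : ℤ_[2]) ^ m' : ℤ_[2]) : ℚ_[2]) = ι (PowerSeries.C ((2 : ℤ_[2]) ^ m')) := by
      rw [hι, iwasawaToPowerSeries, PowerSeries.map_C]; rfl
    have hCb : PowerSeries.C (((u : ℤ_[2]) * (2 : ℤ_[2]) ^ m : ℤ_[2]) : ℚ_[2]) =
        ι (PowerSeries.C ((u : ℤ_[2]) * (2 : ℤ_[2]) ^ m)) := by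
      rw [hι, iwasawaToPowerSeries, PowerSeries.map_C]; rfl
    rw [hR, hRA, hCa, hCb]
    simp only [← map_mul, ← map_sub]
    congr 1
    ring
  · -- `Y = Z + ω_n ρ` in `Λ`
    simp only [hZ, Polynomial.coe_sub, Polynomial.coe_mul, Polynomial.coe_C]
    linear_combination (PowerSeries.C ((2 : ℤ_[2]) ^ m') * (R : PowerSeries ℤ_[2])) * hρW -
      (PowerSeries.C ((u : ℤ_[2]) * (2 : ℤ_[2]) ^ m) * (RA : PowerSeries ℤ_[2])) * hρA
  · -- `Z = 2·2^m·2^{m'}·Δ_n + ω_n H` in `ℚ₂[X]`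
    have hωK : ωZ.map (algebraMap ℤ_[2] ℚ_[2]) = (X + 1 : ℚ_[2][X]) ^ 2 ^ n - 1 := by
      rw [hωZ, Polynomial.map_map, RingHom.ext_int ((algebraMap ℤ_[2] ℚ_[2]).comp (Int.castRingHom ℤ_[2]))
        (Int.castRingHom ℚ_[2]), cyclotomicOmega, Polynomial.map_sub, Polynomial.map_pow, Polynomial.map_add,
        Polynomial.map_X, Polynomial.map_one]
    have hΔ : (∑ s : ZMod (2 ^ n), C (((ϖ * eulerDepleteTableList W l (ratPlusSymbol f) (x s) : ℚ) : ℚ_[2]) -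
          ((u : ℤ_[2]) : ℚ_[2]) * ((ϖA * eulerDepleteTableList A l (ratPlusSymbol fA) (x s) : ℚ) : ℚ_[2])) *
          (X + 1 : ℚ_[2][X]) ^ s.val) =
        C (ϖ : ℚ_[2]) * (∑ s : ZMod (2 ^ n), C ((eulerDepleteTableList W l (ratPlusSymbol f) (x s) : ℚ) : ℚ_[2]) *
            (X + 1 : ℚ_[2][X]) ^ s.val) -
          C (((u : ℤ_[2]) : ℚ_[2])) * C (ϖA : ℚ_[2]) *
            (∑ s : ZMod (2 ^ n), C ((eulerDepleteTableList A l (ratPlusSymbol fA) (x s) : ℚ) : ℚ_[2]) *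
              (X + 1 : ℚ_[2][X]) ^ s.val) := by
      rw [Finset.mul_sum, Finset.mul_sum, ← Finset.sum_sub_distrib]
      refine Finset.sum_congr rfl fun s _ ↦ ?_
      push_cast
      simp only [map_sub, map_mul]
      ring
    rw [hωK, hZmap, hΔ, map_mul, map_mul]
    linear_combination key

end Layer

/-! ## §6. The crux from the depleted-symbol law (SP2) -/

section Main

/-- **`MazurTateCongruenceAtTwoR` (item 21416; = `MazurTateCongruenceAtTwoTop`, item 25797, by name) FROM THE
DEPLETED-SYMBOL LAW (SP2).** Hypothesis (SP2): for every theta pair `(W, A)` as in the crux (habitat binders verbatim),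
newforms `f` of `W` and `f_A` of `A` with period ratios `ϖ, ϖ_A` (`ϖ·Ω_W = Ω⁺_f`, `ϖ_A·Ω_A = Ω⁺_{f_A}`), and every
duplicate-free list `l` of odd places containing the bad places of `W` and of `A`, there is a unit `u ∈ ℤ₂ˣ` such that
for every even `n` and every odd `a`
`‖ϖ · Φ^{l}_W(a/2^{n+2}) − u · ϖ_A · Φ^{l}_A(a/2^{n+2})‖₂ ≤ 1`,
where `Φ^{l}_W = eulerDepleteTableList W l [·]⁺_f`, `Φ^{l}_A = eulerDepleteTableList A l [·]⁺_{f_A}` are the Greenberg–Vatsal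
depleted rational plus-symbol tables (Literature `GreenbergVatsal2000/EulerFactorDepletion`). Conclusion: the crux — at every
even layer, `2^{m'}(2^m ϖ θ_n(f) ι E_W) − u 2^m (2^{m'} ϖ_A θ_n(f_A) ι E_A) ∈ ι((2^{m+m'+1}, ω_n)Λ)` for every Pollack
datum `(L^±, G, m)`, `(L_A^±, G_A, m')` and every admissible `S₀` (take `l = S₀.toList`). Proof: the layer decomposition
(`exists_layer_decomposition`) + (SP2) makes `Δ_n` integral + division by the monic `ω_n` descends to `ℤ₂[X]`
(`Polynomial.map_dvd_map`). Nothing about (SP2) is asserted (research: Vatsal 1999 / Greenberg–Vatsal 2000 §3 read at `p = 2`).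
[cite: GreenbergVatsal2000, §1 p. 9 (display (8)) and §3 (13)] [cite: Vatsal1999, (1.6) and Thm. (1.13)]
[cite: Pollack2003, Prop. 6.18] -/
theorem mazurTateCongruenceAtTwoR_of_depletedSymbolLaw
    (hSP : ∀ (W : WeierstrassCurve ℚ) [W.IsElliptic] [W.IsGloballyMinimal] (A : WeierstrassCurve ℚ) [A.IsElliptic]
      [A.IsGloballyMinimal], ¬ W.HasCM → W.analyticRank = 0 → GoodSS W 2 → W.frobeniusTrace 2 = 0 → A.HasCM →
      GoodSS A 2 → A.frobeniusTrace 2 = 0 →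
      (∃ e : WeierstrassCurve.geomTorsion W (2 : ℤ) ≃+ WeierstrassCurve.geomTorsion A (2 : ℤ),
        ∀ (σ : Field.absoluteGaloisGroup ℚ) (P : WeierstrassCurve.geomTorsion W (2 : ℤ)), e (σ • P) = σ • e P) →
      ∀ [NeZero (W.conductorNorm ℤ)] (f : CuspForm (Gamma0 (W.conductorNorm ℤ)) 2), IsNewformOf W f →
      ∀ (ϖ : ℚ), (ϖ : ℝ) * W.realPeriodRat = plusPeriod f →
      ∀ [NeZero (A.conductorNorm ℤ)] (fA : CuspForm (Gamma0 (A.conductorNorm ℤ)) 2), IsNewformOf A fA →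
      ∀ (ϖA : ℚ), (ϖA : ℝ) * A.realPeriodRat = plusPeriod fA →
      ∀ (l : List (HeightOneSpectrum (𝓞 ℚ))), l.Nodup → (∀ v ∈ l, ((2 : ℕ) : 𝓞 ℚ) ∉ v.asIdeal) →
        (∀ v : HeightOneSpectrum (𝓞 ℚ), ¬ W.HasGoodReductionAt v → v ∈ l) →
        (∀ v : HeightOneSpectrum (𝓞 ℚ), ¬ A.HasGoodReductionAt v → v ∈ l) →
      ∃ u : ℤ_[2]ˣ, ∀ n : ℕ, Even n → ∀ a : ℕ, Odd a →
        ‖((ϖ * eulerDepleteTableList W l (ratPlusSymbol f) ((a : ℚ) / (2 : ℚ) ^ (n + 2)) : ℚ) : ℚ_[2]) -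
            ((u : ℤ_[2]) : ℚ_[2]) *
              ((ϖA * eulerDepleteTableList A l (ratPlusSymbol fA) ((a : ℚ) / (2 : ℚ) ^ (n + 2)) : ℚ) : ℚ_[2])‖ ≤ 1) :
    Summit.BirchSwinnertonDyer.BirchSwinnertonDyer.Theses.ThetaPartnerAtTwo.MazurTateCongruenceAtTwoR := by
  intro W _ _ A _ _ hcm hr hss ha hAcm hAss hAa he γ hγ _ f hf ϖ hϖ Lplus Lminus hPP _ fA hfA ϖA hϖA LplusA LminusA
    hPPA S₀ hS2 hSW hSA G m hG GA m' hGA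
  have hl2 : ∀ v ∈ S₀.toList, ((2 : ℕ) : 𝓞 ℚ) ∉ v.asIdeal := fun v hv ↦ hS2 v (Finset.mem_toList.mp hv)
  obtain ⟨u, hu⟩ := hSP W A hcm hr hss ha hAcm hAss hAa he f hf ϖ hϖ fA hfA ϖA hϖA S₀.toList (Finset.nodup_toList S₀)
    hl2 (fun v hv ↦ Finset.mem_toList.mpr (hSW v hv)) (fun v hv ↦ Finset.mem_toList.mpr (hSA v hv))
  refine ⟨u, fun n hn ↦ ?_⟩
  obtain ⟨Y, Z, ρ, H, hLY, hYZ, hZmap⟩ := exists_layer_decomposition W A f fA hPP hPPA hG hGA S₀ hS2 u hn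
  set ωZ : ℤ_[2][X] := (cyclotomicOmega 2 n).map (Int.castRingHom ℤ_[2]) with hωZ
  -- (SP2) at the sample points `5^s/2^{n+2}`: the coefficients of `Δ_n` are `2`-adic integers
  have hδ : ∀ s : ZMod (2 ^ n),
      ‖((ϖ * eulerDepleteTableList W S₀.toList (ratPlusSymbol f) ((((cyclotomicGenerator 2 : ZMod (2 ^ (n + 2))) ^ s.val).val : ℚ) / (2 : ℚ) ^ (n + 2)) : ℚ) : ℚ_[2]) -
          ((u : ℤ_[2]) : ℚ_[2]) *
            ((ϖA * eulerDepleteTableList A S₀.toList (ratPlusSymbol fA) ((((cyclotomicGenerator 2 : ZMod (2 ^ (n + 2))) ^ s.val).val : ℚ) / (2 : ℚ) ^ (n + 2)) : ℚ) : ℚ_[2])‖ ≤ 1 :=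
    fun s ↦ hu n hn _ (Summit.BirchSwinnertonDyer.Rank1Residual.F1Sign2.odd_val_cyclotomicGenerator_pow n s.val)
  set δ : ZMod (2 ^ n) → ℤ_[2] := fun s ↦ ⟨_, hδ s⟩ with hδdef
  set Δt : ℤ_[2][X] := ∑ s : ZMod (2 ^ n), C (δ s) * (X + 1) ^ s.val with hΔt
  have hΔ : Δt.map (algebraMap ℤ_[2] ℚ_[2]) =
      ∑ s : ZMod (2 ^ n), C (((ϖ * eulerDepleteTableList W S₀.toList (ratPlusSymbol f) ((((cyclotomicGenerator 2 : ZMod (2 ^ (n + 2))) ^ s.val).val : ℚ) / (2 : ℚ) ^ (n + 2)) : ℚ) : ℚ_[2]) -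
        ((u : ℤ_[2]) : ℚ_[2]) *
          ((ϖA * eulerDepleteTableList A S₀.toList (ratPlusSymbol fA) ((((cyclotomicGenerator 2 : ZMod (2 ^ (n + 2))) ^ s.val).val : ℚ) / (2 : ℚ) ^ (n + 2)) : ℚ) : ℚ_[2])) *
        (X + 1 : ℚ_[2][X]) ^ s.val := by
    rw [hΔt, Polynomial.map_sum]
    refine Finset.sum_congr rfl fun s _ ↦ ?_
    rw [Polynomial.map_mul, Polynomial.map_pow, Polynomial.map_add, Polynomial.map_X, Polynomial.map_one,
      Polynomial.map_C]
    rfl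
  -- division by the monic `ω_n` descends to `ℤ₂[X]`
  have hdvd : ωZ ∣ Z - C ((2 : ℤ_[2]) * (2 : ℤ_[2]) ^ m * (2 : ℤ_[2]) ^ m') * Δt := by
    rw [← Polynomial.map_dvd_map (algebraMap ℤ_[2] ℚ_[2]) Subtype.coe_injective ((monic_cyclotomicOmega 2 n).map _),
      Polynomial.map_sub, Polynomial.map_mul, Polynomial.map_C, hZmap, hΔ]
    simp only [map_mul, map_pow, map_ofNat]
    exact ⟨H, by ring⟩
  obtain ⟨Ht, hHt⟩ := hdvd
  -- assembly in `Λ`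
  refine ⟨(Δt : PowerSeries ℤ_[2]), (Ht : PowerSeries ℤ_[2]) + ρ, ?_⟩
  rw [toIwasawa_eq_coe_map, hLY]
  congr 1
  have hZΛ := congrArg (fun P : ℤ_[2][X] ↦ (P : PowerSeries ℤ_[2])) hHt
  simp only [Polynomial.coe_sub, Polynomial.coe_mul, Polynomial.coe_C] at hZΛ
  simp only [map_mul, map_pow] at hZΛ
  rw [hYZ]
  simp only [map_mul, map_pow, pow_add, pow_one]
  linear_combination hZΛ

/-- **The route's crux of record `MazurTateCongruenceAtTwoTop` (item 25797, `:= MazurTateCongruenceAtTwoR`) FROM THE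
DEPLETED-SYMBOL LAW (SP2)** — the same theorem, concluded BY NAME for the top-level twin that `closes` binds (`hMTt`).
[cite: GreenbergVatsal2000, §1 p. 9 (display (8)) and §3 (13)] [cite: Vatsal1999, (1.6) and Thm. (1.13)] -/
theorem mazurTateCongruenceAtTwoTop_of_depletedSymbolLaw
    (hSP : ∀ (W : WeierstrassCurve ℚ) [W.IsElliptic] [W.IsGloballyMinimal] (A : WeierstrassCurve ℚ) [A.IsElliptic]
      [A.IsGloballyMinimal], ¬ W.HasCM → W.analyticRank = 0 → GoodSS W 2 → W.frobeniusTrace 2 = 0 → A.HasCM →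
      GoodSS A 2 → A.frobeniusTrace 2 = 0 →
      (∃ e : WeierstrassCurve.geomTorsion W (2 : ℤ) ≃+ WeierstrassCurve.geomTorsion A (2 : ℤ),
        ∀ (σ : Field.absoluteGaloisGroup ℚ) (P : WeierstrassCurve.geomTorsion W (2 : ℤ)), e (σ • P) = σ • e P) →
      ∀ [NeZero (W.conductorNorm ℤ)] (f : CuspForm (Gamma0 (W.conductorNorm ℤ)) 2), IsNewformOf W f →
      ∀ (ϖ : ℚ), (ϖ : ℝ) * W.realPeriodRat = plusPeriod f →
      ∀ [NeZero (A.conductorNorm ℤ)] (fA : CuspForm (Gamma0 (A.conductorNorm ℤ)) 2), IsNewformOf A fA →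
      ∀ (ϖA : ℚ), (ϖA : ℝ) * A.realPeriodRat = plusPeriod fA →
      ∀ (l : List (HeightOneSpectrum (𝓞 ℚ))), l.Nodup → (∀ v ∈ l, ((2 : ℕ) : 𝓞 ℚ) ∉ v.asIdeal) →
        (∀ v : HeightOneSpectrum (𝓞 ℚ), ¬ W.HasGoodReductionAt v → v ∈ l) →
        (∀ v : HeightOneSpectrum (𝓞 ℚ), ¬ A.HasGoodReductionAt v → v ∈ l) →
      ∃ u : ℤ_[2]ˣ, ∀ n : ℕ, Even n → ∀ a : ℕ, Odd a →
        ‖((ϖ * eulerDepleteTableList W l (ratPlusSymbol f) ((a : ℚ) / (2 : ℚ) ^ (n + 2)) : ℚ) : ℚ_[2]) -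
            ((u : ℤ_[2]) : ℚ_[2]) *
              ((ϖA * eulerDepleteTableList A l (ratPlusSymbol fA) ((a : ℚ) / (2 : ℚ) ^ (n + 2)) : ℚ) : ℚ_[2])‖ ≤ 1) :
    Summit.BirchSwinnertonDyer.BirchSwinnertonDyer.Theses.ThetaPartnerAtTwo.MazurTateCongruenceAtTwoTop :=
  mazurTateCongruenceAtTwoR_of_depletedSymbolLaw hSP

end Main

end Summit.BirchSwinnertonDyer.BirchSwinnertonDyer.Theorems.MazurTateCongruenceAtTwoR

end
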